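import Mathlib.Data.Fin.Tuple.Sort
import Literature.Combinatorics.Sahi2008.Indicators
import Summits.CriticalPhenomena.PercolationContinuityZ3.Theorems.SahiLiebSahiContinuum
import Summits.CriticalPhenomena.PercolationContinuityZ3.Theorems.PercNearOneGluingNoHeavyLowerTailSahiSlotPatternBridge

/-!
# The without-replacement / pattern device at every order `n` and every dimension `d` — II, THE FINITE OBLIGATION `SlotPatternPos d n` AND ITS CONSEQUENCES

Support file of the one-cut programme (crux `NoHeavyLowerTail`, stmt-CriticalPhenomena-4575; cell `prim-masterthm`, seat P3, gen 18;
`run/shared/lean/prim/prim-masterthm/prim-masterthm-p3/HIERARCHY.md` §26).  Sequel of `…SahiSlotPatternBridge` (the identities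
`E_n^{⊗g}(f) = Σ_r w(r)·diagForm(f∘slot_r)` and `(n!)^d·E_n^{⊗g}(f) = Σ_r w(r)·patternForm(f∘slot_r)`, relabelling invariance `patternForm_comp_act`).

* `SahiSlot.pullSet`, `setInd_comp_slotMap`, `isUpperSet_pullSet` — up-sets of the grid pull back, along slot maps with monotone axes, to up-sets of the slot cube;
* **`SahiSlot.SlotPatternPos d n`** (`@[conjecture]`; a FINITE statement for each `(d,n)`): `patternForm d n ≥ 0` on every `n`-tuple of up-sets of `Q = [n]^d`;
* `patternForm_pullback_nonneg` — SORTING: relabel every axis by `Tuple.sort`; then **`sahiE_gridW_indicator_nonneg`**, **`sahiPositive_gridW_of_slotPatternPos`**: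
  `SlotPatternPos d n ⇒` every product probability weight on every grid `Fin d → Y` (`Y` a finite chain) is Sahi-positive of order `n` (layer cake
  `sahiPositive_iff_indicators` of the tree);
* **`liebSahiContinuum_of_slotPatternPos : SlotPatternPos d n → LiebSahiContinuum d n`** (Lieb–Sahi's Conjecture 1.1 on `[0,1]^d` at order `n`),
  `sahiPositive_of_slotPatternPos_of_latticeEmbedding` (every FKG weight on every lattice of J-width `≤ d`),
  **`sahiConjecture_of_forall_slotPatternPos : (∀ d, SlotPatternPos d n) → SahiConjecture n`**, `kahnConjecture_of_forall_slotPatternPos_three`,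
  `sahiGFConjecture_of_forall_slotPatternPos`;
* `slotPatternPos_one` (order 1 is trivial); cylinders `patternForm_comp_tail` (`patternForm_{d+1}(h∘tail) = n!·patternForm_d(h)`) and
  **`SlotPatternPos.of_succ` / `SlotPatternPos.of_le`**: the obligation is antitone in the dimension.
So Sahi's Conjecture 5 at order `n` follows from countably many FINITE integer inequalities, one per dimension `d`; KNOWN cells: `d ≤ 2` all `n` (Lieb–Sahi;
P3 gen 16 coefficientwise), `(3,3)` (kernel: prim-sahi-p1 `SahiGrid3`, P3 gen 17 `slotPos`), `(4,3)` certified outside the kernel (prim-sahi-p1 gen 8); the first open cell at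
order 4 is `(3,4)` (adversarial census this gen, kit j159268).  HONEST LABEL: reductions; nothing here asserts `SlotPatternPos d n` for `n ≥ 2`.
Everything proved; axioms standard. [this work]
-/

noncomputable section

namespace Summit.CriticalPhenomena.PercolationContinuityZ3.Theorems

open Finset Function Equiv Equiv.Perm
open Literature.Combinatorics.Sahi2008 Literature.Combinatorics.Sahi2008.CycleForm

namespace SahiSlot

/-! ### Sorting, the finite positivity statement, and its consequences -/

section Positivity

variable {d n : ℕ} {Y : Type*}

/-- Pull-back of a finite subset of the grid along a slot map: `{q : slot_r(q) ∈ U}`. [this work] -/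
def pullSet [DecidableEq Y] (r : Fin d → Fin n → Y) (U : Finset (Fin d → Y)) : Finset (Q d n) :=
  univ.filter fun q => slotMap r q ∈ U

/-- Indicators pull back to indicators of the pulled-back set. [this work] -/
theorem setInd_comp_slotMap [DecidableEq Y] (r : Fin d → Fin n → Y) (U : Finset (Fin d → Y)) :
    setInd U ∘ slotMap r = setInd (pullSet r U) := by
  funext q
  simp only [comp_apply, setInd, pullSet, mem_filter, mem_univ, true_and]

/-- Along a slot map with monotone axes, up-sets pull back to up-sets of the slot cube. [this work] -/
theorem isUpperSet_pullSet [DecidableEq Y] [Preorder Y] {r : Fin d → Fin n → Y} (hr : ∀ a, Monotone (r a)) {U : Finset (Fin d → Y)}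
    (hU : IsUpperSet (U : Set (Fin d → Y))) : IsUpperSet (pullSet r U : Set (Q d n)) := by
  intro q q' hqq' hq
  rw [mem_coe] at hq ⊢
  simp only [pullSet, mem_filter, mem_univ, true_and] at hq ⊢
  exact hU (slotMap_mono hr hqq') hq

/-- **Slot-pattern positivity at order `n` in dimension `d`** — a FINITE statement: the pattern functional is nonnegative on every `n`-tuple of up-sets of
the slot cube `[n]^d`.  KNOWN: `d ≤ 2` all `n` (Lieb–Sahi; P3 gen 16 `SahiTwoChain.et_coef_nonneg`), `(3,3)` (prim-sahi-p1 `SahiGrid3`, P3 gen 17 `slotPos`),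
`(4,3)` certified outside the kernel (prim-sahi-p1 gen 8); every other cell with `d ≥ 3`, `n ≥ 3` is OPEN.  An obligation / hypothesis — never a fact.
[this work] [status: open] -/
@[conjecture] def SlotPatternPos (d n : ℕ) : Prop :=
  ∀ U : Fin n → Finset (Q d n), (∀ i, IsUpperSet ((U i : Finset (Q d n)) : Set (Q d n))) → 0 ≤ patternForm d n (fun i => setInd (U i))

/-- **Sorting**: under `SlotPatternPos d n`, the pattern functional is nonnegative on the pull-back of ANY up-set family along ANY family of slot maps —
relabel each axis by `Tuple.sort` (invariance `patternForm_comp_act`), after which the slot map is monotone. [this work] -/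
theorem patternForm_pullback_nonneg [DecidableEq Y] [LinearOrder Y] (h : SlotPatternPos d n) (r : Fin d → Fin n → Y)
    (U : Fin n → Finset (Fin d → Y)) (hU : ∀ i, IsUpperSet ((U i : Finset (Fin d → Y)) : Set (Fin d → Y))) :
    0 ≤ patternForm d n (fun i => setInd (U i) ∘ slotMap r) := by
  set τ : Fin d → Perm (Fin n) := fun a => Tuple.sort (r a) with hτ
  have hsort : ∀ a, Monotone (r a ∘ τ a) := fun a => Tuple.monotone_sort (r a)
  rw [← patternForm_comp_act _ τ]
  have h2 : (fun i => (setInd (U i) ∘ slotMap r) ∘ act τ) = fun i => setInd (pullSet (fun a => r a ∘ τ a) (U i)) := by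
    funext i
    rw [comp_assoc, ← slotMap_comp_act, setInd_comp_slotMap]
  rw [h2]
  exact h _ fun i => isUpperSet_pullSet hsort (hU i)

/-- **`E_n ≥ 0` on up-set indicators under every product grid weight**, given `SlotPatternPos d n`. [this work] -/
theorem sahiE_gridW_indicator_nonneg [DecidableEq Y] [LinearOrder Y] [Fintype Y] (h : SlotPatternPos d n) (g : Fin d → Y → ℝ)
    (hg0 : ∀ a y, 0 ≤ g a y) (hg1 : ∀ a, ∑ y, g a y = 1) (U : Fin n → Finset (Fin d → Y))
    (hU : ∀ i, IsUpperSet ((U i : Finset (Fin d → Y)) : Set (Fin d → Y))) : 0 ≤ sahiE (gridW g) n (fun i => setInd (U i)) := by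
  rcases Nat.eq_zero_or_pos n with rfl | hn
  · rw [sahiE_zero]
  have hcard : (0 : ℝ) < Fintype.card (Fin d → Perm (Fin n)) := by exact_mod_cast Fintype.card_pos
  have hsum : 0 ≤ ∑ r : Fin d → Fin n → Y, slotW g r * patternForm d n (fun i => setInd (U i) ∘ slotMap r) :=
    sum_nonneg fun r _ => mul_nonneg (prod_nonneg fun a _ => prod_nonneg fun j _ => hg0 a _) (patternForm_pullback_nonneg h r U hU)
  rw [← card_mul_sahiE_gridW_eq_sum_patternForm g hg1 hn] at hsum
  exact (mul_nonneg_iff_of_pos_left hcard).1 hsum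

/-- **`SlotPatternPos d n ⇒` every product probability weight on every `d`-dimensional grid is Sahi-positive of order `n`** (layer cake
`sahiPositive_iff_indicators` + the bridge + sorting). [this work] -/
theorem sahiPositive_gridW_of_slotPatternPos [LinearOrder Y] [Fintype Y] (h : SlotPatternPos d n) (g : Fin d → Y → ℝ) (hg0 : ∀ a y, 0 ≤ g a y)
    (hg1 : ∀ a, ∑ y, g a y = 1) : SahiPositive (gridW g) n := by
  classical
  rw [sahiPositive_iff_indicators]
  intro U hU
  exact sahiE_gridW_indicator_nonneg h g hg0 hg1 U hU

/-- **`SlotPatternPos d n ⇒ LiebSahiContinuum d n`**: Lieb–Sahi's Conjecture 1.1 on the unit cube `[0,1]^d` at order `n` (Lebesgue measure, positive monotone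
functions) follows from the finite slot statement, through the tree's `liebSahiContinuum_iff_prodGrid`. [this work] -/
theorem liebSahiContinuum_of_slotPatternPos (h : SlotPatternPos d n) : LiebSahiContinuum d n :=
  (liebSahiContinuum_iff_prodGrid d n).2 fun _ g hg0 hg1 => sahiPositive_gridW_of_slotPatternPos h g hg0 hg1

/-- **… and every FKG weight on every finite distributive lattice of J-width `≤ d`** is then Sahi-positive of order `n`. [this work] -/
theorem sahiPositive_of_slotPatternPos_of_latticeEmbedding (h : SlotPatternPos d n) {L : Type*} [DistribLattice L] [Fintype L] [DecidableEq L]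
    {b : ℕ} (e : L → (Fin d → Fin (b + 1))) (he : Function.Injective e) (hinf : ∀ x y, e (x ⊓ y) = e x ⊓ e y)
    (hsup : ∀ x y, e (x ⊔ y) = e x ⊔ e y) {μ : L → ℝ} (hμ : IsFKGMeasure μ) : SahiPositive μ n :=
  sahiPositive_of_liebSahiContinuum_of_latticeEmbedding (liebSahiContinuum_of_slotPatternPos h) e he hinf hsup hμ

/-- **Sahi's Conjecture 5 at order `n` follows from slot-pattern positivity in every dimension**: `(∀ d, SlotPatternPos d n) → SahiConjecture n` — countably many
FINITE integer inequalities, one per dimension. [this work] -/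
theorem sahiConjecture_of_forall_slotPatternPos {n : ℕ} (h : ∀ d, SlotPatternPos d n) : SahiConjecture n :=
  (sahiConjecture_iff_forall_liebSahiContinuum n).2 fun d => liebSahiContinuum_of_slotPatternPos (h d)

/-- **Kahn's Conjecture 5** (`C₃` for product measures) follows from order-3 slot-pattern positivity in every dimension (prim-sahi's
`kahnConjecture_of_forall_patternPos` is the same statement for their order-3 functional `sStarD`). [this work] -/
theorem kahnConjecture_of_forall_slotPatternPos_three (h : ∀ d, SlotPatternPos d 3) : KahnConjecture :=
  kahnConjecture_iff_forall_liebSahiContinuum_three.2 fun d => liebSahiContinuum_of_slotPatternPos (h d)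

/-- **All orders**: slot-pattern positivity in every cell `(d,n)` gives Sahi's Conjecture 5 at every order, hence his Conjecture 4 / Lieb–Sahi's Conjecture 1.2
(`SahiGFConjecture`). [this work] -/
theorem sahiGFConjecture_of_forall_slotPatternPos (h : ∀ d n, SlotPatternPos d n) : SahiGFConjecture :=
  sahiGFConjecture_iff_forall_liebSahiContinuum.2 fun d n => liebSahiContinuum_of_slotPatternPos (h d n)

/-- Order `1` is trivial: the pattern functional of one indicator is a sum of its values. [this work] -/
theorem slotPatternPos_one (d : ℕ) : SlotPatternPos d 1 := by
  intro U _
  unfold patternForm diagForm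
  refine sum_nonneg fun τ _ => sum_nonneg fun σ _ => ?_
  have hcard : (orbits σ).card = 1 := by
    refine le_antisymm ?_ (card_pos.2 ⟨_, orbit_mem_orbits σ 0⟩)
    calc (orbits σ).card ≤ (univ : Finset (Fin 1)).card := Finset.card_image_le
      _ = 1 := by simp
  rw [hcard, Nat.sub_self, pow_zero, one_mul]
  exact prod_nonneg fun i _ => setInd_nonneg _ _

end Positivity

/-! ### Monotonicity in the dimension: cylinders -/

section Dimension

variable {d n : ℕ}

/-- The cylinder over `U ⊆ [n]^d` in `[n]^{d+1}` (ignore axis `0`). [this work] -/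
def cylSet (U : Finset (Q d n)) : Finset (Q (d + 1) n) := univ.filter fun q => Fin.tail q ∈ U

/-- The indicator of the cylinder is the indicator of the base read through `Fin.tail`. [this work] -/
theorem setInd_cylSet (U : Finset (Q d n)) : setInd (cylSet U) = setInd U ∘ Fin.tail := by
  funext q
  simp only [setInd, cylSet, mem_filter, mem_univ, true_and, comp_apply]

/-- Cylinders over up-sets are up-sets. [this work] -/
theorem isUpperSet_cylSet {U : Finset (Q d n)} (hU : IsUpperSet (U : Set (Q d n))) : IsUpperSet (cylSet U : Set (Q (d + 1) n)) := by
  intro q q' hqq' hq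
  rw [mem_coe] at hq ⊢
  simp only [cylSet, mem_filter, mem_univ, true_and] at hq ⊢
  exact hU (fun a => hqq' a.succ) hq

/-- The diagonal form of a cylinder family only sees the relabellings of the base axes. [this work] -/
theorem diagForm_comp_tail (h : Fin n → Q d n → ℝ) (τ : Fin (d + 1) → Perm (Fin n)) :
    diagForm (d + 1) n (fun i => (h i ∘ Fin.tail) ∘ act τ) = diagForm d n (fun i => h i ∘ act (Fin.tail τ)) := rfl

/-- **Cylinders**: `patternForm_{d+1}(h ∘ tail) = n! · patternForm_d(h)`. [this work] -/
theorem patternForm_comp_tail (h : Fin n → Q d n → ℝ) :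
    patternForm (d + 1) n (fun i => h i ∘ Fin.tail) = (Fintype.card (Perm (Fin n)) : ℝ) * patternForm d n h := by
  unfold patternForm
  simp_rw [diagForm_comp_tail]
  rw [← (Fin.consEquiv fun _ : Fin (d + 1) => Perm (Fin n)).sum_comp]
  simp only [Fin.consEquiv, Equiv.coe_fn_mk, Fin.tail_cons]
  rw [Fintype.sum_prod_type]
  simp only [sum_const, card_univ, nsmul_eq_mul]

/-- **Slot-pattern positivity is antitone in the dimension**: `SlotPatternPos (d+1) n → SlotPatternPos d n`. [this work] -/
theorem SlotPatternPos.of_succ (h : SlotPatternPos (d + 1) n) : SlotPatternPos d n := by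
  intro U hU
  have hcard : (0 : ℝ) < Fintype.card (Perm (Fin n)) := by exact_mod_cast Fintype.card_pos
  have h1 := h (fun i => cylSet (U i)) fun i => isUpperSet_cylSet (hU i)
  simp_rw [setInd_cylSet] at h1
  rw [patternForm_comp_tail] at h1
  exact (mul_nonneg_iff_of_pos_left hcard).1 h1

/-- `SlotPatternPos d' n → SlotPatternPos d n` for `d ≤ d'`. [this work] -/
theorem SlotPatternPos.of_le {d d' : ℕ} (hdd' : d ≤ d') (h : SlotPatternPos d' n) : SlotPatternPos d n := by
  obtain ⟨k, rfl⟩ := Nat.exists_eq_add_of_le hdd'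
  induction k with
  | zero => simpa using h
  | succ k ih => exact ih (Nat.le_add_right d k) (SlotPatternPos.of_succ (by rw [← Nat.add_assoc] at h; exact h))

end Dimension

end SahiSlot

end Summit.CriticalPhenomena.PercolationContinuityZ3.Theorems
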